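import Literature.NumberTheory.Sieve.SmoothParityMajorModel
import Literature.NumberTheory.Sieve.SmoothEndgamePoints
import HarnessLib

/-!
# Lattice sums on the circle with one and two decaying factors (tools for the major arcs)

Topic `Literature/NumberTheory/Sieve`, namespace `Literature.NumberTheory.Sieve.SmoothArcs`; a PROVED tool file for the
circle-method engine of `SmoothParityTernary` ([Harper2016, §5]).  On the `N₀` sample points `r/N₀` of the circle the
distance to a centre `c` is `‖r/N₀ − c‖` (`distInt`, distance to the nearest integer); the model exponential sums of
the major-arc main term decay like `1/(1 + X_i ‖d_i(r/N₀ − c)‖)` (`SmoothProfileModelBounds`), and the error terms of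
the major-arc pointwise estimate like products of two such factors.  This file bounds the resulting lattice sums
with explicit constants:

* `sum_range_antitone_distInt_le` (CIRCLE ↦ HALF-LINE): for `φ ≥ 0` antitone on `[0, ∞)`,
  `Σ_{r<N₀} φ(N₀‖r/N₀ − c‖) ≤ 4 Σ_{j<N₀} φ(j)` (four monotone injections `r ↦ j` with `N₀‖r/N₀ − c‖ ≥ j`);
* the lattice bounds `sum_range_inv_one_add_distInt_le` (`Σ_r 1/(1 + A‖·‖) ≤ 4(1 + (N₀/A)(1 + log N₀))`),
  `sum_range_inv_mul_inv_distInt_le` (`Σ_r 1/((1+A‖·‖)(1+B‖·‖)) ≤ 4(1 + (N₀/A)(3 + |log(B/N₀)|))`, `B ≤ A`),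
  `sum_filter_inv_mul_inv_distInt_le` (OFF an arc of radius `ρ`, `ρN₀ ≥ 1`: `≤ 16 N₀/(ABρ)`),
  from the harmonic-type bounds of `SmoothParityMajorModel`.

The count of the points of an arc and the resonant off-arc sum (dilated second factor) are in the sequel
`SmoothParityMajorArcsPrep`.

## References

* A. J. Harper, Compositio Math. 152 (2016), §5 [Harper2016].
-/

noncomputable section

open Finset Real

namespace Literature.NumberTheory.Sieve

namespace SmoothArcs

open Endgame Vinogradov

/-! ### From the circle to the half-line -/

/-- **Lattice points of the circle against a monotone majorant.**  For `N₀ ≥ 1`, any centre `c`, and `φ ≥ 0`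
antitone on `[0, ∞)`: `Σ_{r<N₀} φ(N₀ ‖r/N₀ − c‖) ≤ 4 Σ_{j<N₀} φ(j)`.
Proof: reduce to `c ∈ [0,1)`, put `c' = cN₀`, `m = ⌊c'⌋`; for `r ≤ m` one has `N₀‖r/N₀ − c‖ ≥ min(m − r, r)` and for
`r > m`, `N₀‖r/N₀ − c‖ ≥ min(r − m − 1, N₀ − 1 − r)` (`‖θ‖ ≥ min(θ, 1 − θ)`); on each of the four resulting blocks the
relevant index is an injection into `[0, N₀)`. [folklore] -/
theorem sum_range_antitone_distInt_le {N₀ : ℕ} (hN : 0 < N₀) (c : ℝ) {φ : ℝ → ℝ} (hφ0 : ∀ v, 0 ≤ v → 0 ≤ φ v)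
    (hφ : ∀ v w, 0 ≤ v → v ≤ w → φ w ≤ φ v) :
    ∑ r ∈ Finset.range N₀, φ (N₀ * distInt ((r : ℝ) / N₀ - c)) ≤ 4 * ∑ j ∈ Finset.range N₀, φ j := by
  classical
  have hN0 : (0 : ℝ) < N₀ := by exact_mod_cast hN
  -- reduce to `c ∈ [0, 1)`
  set c₀ : ℝ := Int.fract c with hc₀def
  have hc₀ : 0 ≤ c₀ := Int.fract_nonneg c
  have hc₁ : c₀ < 1 := Int.fract_lt_one c
  have hdist : ∀ r : ℕ, distInt ((r : ℝ) / N₀ - c) = distInt ((r : ℝ) / N₀ - c₀) := by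
    intro r
    have e : (r : ℝ) / N₀ - c = (r : ℝ) / N₀ - c₀ + ((-⌊c⌋ : ℤ) : ℝ) := by
      rw [Int.cast_neg, hc₀def, Int.fract]; ring
    rw [e, distInt_add_int]
  simp_rw [hdist]
  set c' : ℝ := c₀ * N₀ with hc'
  set m : ℕ := ⌊c'⌋₊ with hm
  have hc'0 : 0 ≤ c' := by positivity
  have hmc : (m : ℝ) ≤ c' := Nat.floor_le hc'0
  have hcm : c' < m + 1 := Nat.lt_floor_add_one c'
  have hc'N : c' < N₀ := by rw [hc']; exact mul_lt_of_lt_one_left hN0 hc₁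
  have hmN : m < N₀ := (Nat.floor_lt hc'0).mpr hc'N
  set f : ℕ → ℝ := fun r => φ (N₀ * distInt ((r : ℝ) / N₀ - c₀)) with hf
  set g : ℕ → ℝ := fun j => φ j with hg
  have hg0 : ∀ j ∈ Finset.range N₀, 0 ≤ g j := fun j _ => hφ0 _ (Nat.cast_nonneg j)
  have hu : ∀ r : ℕ, (r : ℝ) / N₀ - c₀ = ((r : ℝ) - c') / N₀ := by intro r; rw [hc']; field_simp
  -- the comparison `f r ≤ g j` once `j ≤ N₀ ‖·‖`
  have key : ∀ r j : ℕ, (j : ℝ) ≤ N₀ * distInt ((r : ℝ) / N₀ - c₀) → f r ≤ g j :=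
    fun r j hj => hφ _ _ (Nat.cast_nonneg j) hj
  -- lower bounds for the distance
  have hleft : ∀ r : ℕ, r ≤ m → min ((m : ℝ) - r) r ≤ N₀ * distInt ((r : ℝ) / N₀ - c₀) := by
    intro r hrm
    have e1 : distInt ((r : ℝ) / N₀ - c₀) = distInt ((c' - r) / N₀) := by
      rw [hu, ← distInt_neg, ← neg_div, neg_sub]
    rw [e1]
    have h2 := min_le_distInt ((c' - r) / N₀)
    have h3 : min ((m : ℝ) - r) r / N₀ ≤ min ((c' - r) / N₀) (1 - (c' - r) / N₀) := by
      rw [← min_div_div_right hN0.le]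
      refine min_le_min (div_le_div_of_nonneg_right (by linarith) hN0.le) ?_
      rw [div_le_iff₀ hN0, sub_mul, div_mul_cancel₀ _ hN0.ne', one_mul]
      have : (m : ℝ) + 1 ≤ N₀ := by exact_mod_cast hmN
      linarith
    have h4 := h3.trans h2
    rwa [div_le_iff₀ hN0, mul_comm] at h4
  have hright : ∀ r : ℕ, m < r → r < N₀ →
      min ((r : ℝ) - m - 1) ((N₀ : ℝ) - 1 - r) ≤ N₀ * distInt ((r : ℝ) / N₀ - c₀) := by
    intro r hmr hrN
    rw [hu]
    have h2 := min_le_distInt (((r : ℝ) - c') / N₀)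
    have h3 : min ((r : ℝ) - m - 1) ((N₀ : ℝ) - 1 - r) / N₀ ≤ min (((r : ℝ) - c') / N₀) (1 - ((r : ℝ) - c') / N₀) := by
      rw [← min_div_div_right hN0.le]
      refine min_le_min (div_le_div_of_nonneg_right (by linarith) hN0.le) ?_
      rw [div_le_iff₀ hN0, sub_mul, div_mul_cancel₀ _ hN0.ne', one_mul]
      linarith
    have h4 := h3.trans h2
    rwa [div_le_iff₀ hN0, mul_comm] at h4
  -- the four blocks
  have hB₁ : ∑ r ∈ (Finset.range N₀).filter (fun r => r ≤ m ∧ m ≤ 2 * r), f r ≤ ∑ j ∈ Finset.range N₀, g j := by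
    refine sum_le_sum_of_injOn' (fun r => m - r) ?_ ?_ f g hg0 ?_
    · intro r₁ hr₁ r₂ hr₂ heq
      have h1 := (Finset.mem_filter.mp hr₁).2.1
      have h2 := (Finset.mem_filter.mp hr₂).2.1
      simp only at heq
      omega
    · intro r _; exact Finset.mem_range.mpr (by omega)
    · intro r hr
      obtain ⟨-, hrm, h2r⟩ := Finset.mem_filter.mp hr
      refine key r (m - r) ?_
      rw [Nat.cast_sub hrm]
      refine le_trans ?_ (hleft r hrm)
      have : (m : ℝ) ≤ 2 * r := by exact_mod_cast h2r
      rw [min_eq_left (by linarith)]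
  have hB₂ : ∑ r ∈ (Finset.range N₀).filter (fun r => r ≤ m ∧ ¬ m ≤ 2 * r), f r ≤ ∑ j ∈ Finset.range N₀, g j := by
    refine sum_le_sum_of_injOn' (fun r => r) (fun _ _ _ _ h => h) ?_ f g hg0 ?_
    · intro r hr; exact (Finset.mem_filter.mp hr).1
    · intro r hr
      obtain ⟨-, hrm, h2r⟩ := Finset.mem_filter.mp hr
      refine key r r (le_trans ?_ (hleft r hrm))
      have : 2 * (r : ℝ) < m := by exact_mod_cast (not_le.mp h2r)
      rw [min_eq_right (by linarith)]
  have hB₃ : ∑ r ∈ (Finset.range N₀).filter (fun r => ¬ r ≤ m ∧ 2 * r ≤ N₀ + m), f r ≤ ∑ j ∈ Finset.range N₀, g j := by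
    refine sum_le_sum_of_injOn' (fun r => r - (m + 1)) ?_ ?_ f g hg0 ?_
    · intro r₁ hr₁ r₂ hr₂ heq
      have h1 := (Finset.mem_filter.mp hr₁).2.1
      have h2 := (Finset.mem_filter.mp hr₂).2.1
      simp only at heq
      omega
    · intro r hr
      have := Finset.mem_range.mp (Finset.mem_filter.mp hr).1
      exact Finset.mem_range.mpr (by omega)
    · intro r hr
      obtain ⟨hrN, hrm, h2r⟩ := Finset.mem_filter.mp hr
      have hrN' := Finset.mem_range.mp hrN
      have hmr : m < r := not_le.mp hrm
      refine key r (r - (m + 1)) (le_trans ?_ (hright r hmr hrN'))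
      rw [Nat.cast_sub (by omega : m + 1 ≤ r)]
      push_cast
      have : 2 * (r : ℝ) ≤ N₀ + m := by exact_mod_cast h2r
      rw [min_eq_left (by linarith)]
      linarith
  have hB₄ : ∑ r ∈ (Finset.range N₀).filter (fun r => ¬ r ≤ m ∧ ¬ 2 * r ≤ N₀ + m), f r ≤
      ∑ j ∈ Finset.range N₀, g j := by
    refine sum_le_sum_of_injOn' (fun r => N₀ - 1 - r) ?_ ?_ f g hg0 ?_
    · intro r₁ hr₁ r₂ hr₂ heq
      have h1 := Finset.mem_range.mp (Finset.mem_filter.mp hr₁).1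
      have h2 := Finset.mem_range.mp (Finset.mem_filter.mp hr₂).1
      simp only at heq
      omega
    · intro r _; exact Finset.mem_range.mpr (by omega)
    · intro r hr
      obtain ⟨hrN, hrm, h2r⟩ := Finset.mem_filter.mp hr
      have hrN' := Finset.mem_range.mp hrN
      have hmr : m < r := not_le.mp hrm
      refine key r (N₀ - 1 - r) (le_trans ?_ (hright r hmr hrN'))
      rw [Nat.sub_sub, Nat.cast_sub (by omega : 1 + r ≤ N₀)]
      push_cast
      have : (N₀ : ℝ) + m < 2 * r := by exact_mod_cast (not_le.mp h2r)
      rw [min_eq_right (by linarith)]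
      linarith
  -- assemble
  rw [← Finset.sum_filter_add_sum_filter_not (Finset.range N₀) (fun r => r ≤ m) f,
    ← Finset.sum_filter_add_sum_filter_not ((Finset.range N₀).filter (fun r => r ≤ m)) (fun r => m ≤ 2 * r) f,
    ← Finset.sum_filter_add_sum_filter_not ((Finset.range N₀).filter (fun r => ¬ r ≤ m)) (fun r => 2 * r ≤ N₀ + m) f,
    Finset.filter_filter, Finset.filter_filter, Finset.filter_filter, Finset.filter_filter]
  linarith

/-! ### The lattice bounds -/

/-- **One decaying factor.** For `N₀ ≥ 1`, `A > 0` and any centre `c`: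
`Σ_{r<N₀} 1/(1 + A‖r/N₀ − c‖) ≤ 4 (1 + (N₀/A)(1 + log N₀))`. [folklore] -/
theorem sum_range_inv_one_add_distInt_le {N₀ : ℕ} (hN : 0 < N₀) {A : ℝ} (hA : 0 < A) (c : ℝ) :
    ∑ r ∈ Finset.range N₀, 1 / (1 + A * distInt ((r : ℝ) / N₀ - c)) ≤
      4 * (1 + (N₀ : ℝ) / A * (1 + Real.log N₀)) := by
  have hN0 : (0 : ℝ) < N₀ := by exact_mod_cast hN
  have ha : 0 < A / N₀ := div_pos hA hN0
  have h := sum_range_antitone_distInt_le hN c (φ := fun v => 1 / (1 + A / N₀ * v))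
    (fun v hv => by positivity) (fun v w hv hvw => by
      apply one_div_le_one_div_of_le (by positivity)
      have := mul_le_mul_of_nonneg_left hvw ha.le
      linarith)
  have e : ∀ r : ℕ, 1 / (1 + A / N₀ * (N₀ * distInt ((r : ℝ) / N₀ - c))) = 1 / (1 + A * distInt ((r : ℝ) / N₀ - c)) := by
    intro r; congr 2; field_simp
  simp only [e] at h
  refine h.trans (mul_le_mul_of_nonneg_left ((sum_range_inv_one_add_mul_le ha N₀).trans (le_of_eq ?_)) (by norm_num))
  field_simp

/-- **Two decaying factors along an arc.** For `N₀ ≥ 1`, `0 < B ≤ A` and any centre `c`: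
`Σ_{r<N₀} 1/((1 + A‖r/N₀ − c‖)(1 + B‖r/N₀ − c‖)) ≤ 4 (1 + (N₀/A)(3 + |log(B/N₀)|))`. [folklore] -/
theorem sum_range_inv_mul_inv_distInt_le {N₀ : ℕ} (hN : 0 < N₀) {A B : ℝ} (hB : 0 < B) (hBA : B ≤ A) (c : ℝ) :
    ∑ r ∈ Finset.range N₀, 1 / ((1 + A * distInt ((r : ℝ) / N₀ - c)) * (1 + B * distInt ((r : ℝ) / N₀ - c))) ≤
      4 * (1 + (N₀ : ℝ) / A * (3 + |Real.log (B / N₀)|)) := by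
  have hN0 : (0 : ℝ) < N₀ := by exact_mod_cast hN
  have hA : 0 < A := lt_of_lt_of_le hB hBA
  have ha : 0 < A / N₀ := div_pos hA hN0
  have hb : 0 < B / N₀ := div_pos hB hN0
  have hba : B / N₀ ≤ A / N₀ := div_le_div_of_nonneg_right hBA hN0.le
  have h := sum_range_antitone_distInt_le hN c (φ := fun v => 1 / ((1 + A / N₀ * v) * (1 + B / N₀ * v)))
    (fun v hv => by positivity) (fun v w hv hvw => by
      apply one_div_le_one_div_of_le (by positivity)
      have hw : 0 ≤ w := hv.trans hvw
      have h1 := mul_le_mul_of_nonneg_left hvw ha.le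
      have h2 := mul_le_mul_of_nonneg_left hvw hb.le
      exact mul_le_mul (by linarith) (by linarith) (by positivity) (by positivity))
  have e : ∀ r : ℕ, 1 / ((1 + A / N₀ * (N₀ * distInt ((r : ℝ) / N₀ - c))) * (1 + B / N₀ * (N₀ * distInt ((r : ℝ) / N₀ - c)))) =
      1 / ((1 + A * distInt ((r : ℝ) / N₀ - c)) * (1 + B * distInt ((r : ℝ) / N₀ - c))) := by
    intro r; congr 2 <;> field_simp
  simp only [e] at h
  refine h.trans (mul_le_mul_of_nonneg_left ?_ (by norm_num))
  -- `Σ_{j<N₀} φ(j) = φ(0) + Σ_{1 ≤ j ≤ N₀ - 1} φ(j)`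
  rcases Nat.eq_zero_or_pos N₀ with h0 | _
  · omega
  obtain ⟨M, rfl⟩ : ∃ M, N₀ = M + 1 := ⟨N₀ - 1, by omega⟩
  rw [Finset.range_eq_Ico, Finset.sum_eq_sum_Ico_succ_bot (Nat.succ_pos M)]
  simp only [Nat.cast_zero, mul_zero, add_zero, mul_one, div_one, zero_add, Nat.succ_eq_add_one]
  rw [show Ico 1 (M + 1) = Icc 1 M from rfl]
  refine add_le_add le_rfl ((sum_Icc_inv_mul_inv_le hb hba M).trans (le_of_eq ?_))
  field_simp

/-- **Two decaying factors off an arc.** For `N₀ ≥ 1`, `A, B > 0`, a radius `ρ > 0` with `ρN₀ ≥ 1` and any centre `c`: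
`Σ_{r<N₀, ‖r/N₀ − c‖ > ρ} 1/((1 + A‖r/N₀ − c‖)(1 + B‖r/N₀ − c‖)) ≤ 16 N₀/(ABρ)`
(majorant `φ(v) = 1/((1 + A max(v,ρN₀)/N₀)(1 + B max(v,ρN₀)/N₀))`: `ρN₀ + 1 ≤ 2ρN₀` terms `≤ 1/(ABρ²)` and the tail
`Σ_{j>ρN₀} N₀²/(ABj²) ≤ 2N₀/(ABρ)`). [folklore] -/
theorem sum_filter_inv_mul_inv_distInt_le {N₀ : ℕ} (hN : 0 < N₀) {A B ρ : ℝ} (hA : 0 < A) (hB : 0 < B) (hρ : 0 < ρ)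
    (hρN : 1 ≤ ρ * N₀) (c : ℝ) :
    ∑ r ∈ (Finset.range N₀).filter (fun r : ℕ => ρ < distInt ((r : ℝ) / N₀ - c)),
        1 / ((1 + A * distInt ((r : ℝ) / N₀ - c)) * (1 + B * distInt ((r : ℝ) / N₀ - c))) ≤
      16 * N₀ / (A * B * ρ) := by
  have hN0 : (0 : ℝ) < N₀ := by exact_mod_cast hN
  set V : ℝ := ρ * N₀ with hV
  have hV0 : 0 < V := by positivity
  set φ : ℝ → ℝ := fun v => 1 / ((1 + A / N₀ * max v V) * (1 + B / N₀ * max v V)) with hφ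
  have hφ0 : ∀ v, 0 ≤ v → 0 ≤ φ v := fun v _ => by
    simp only [hφ]; have : 0 ≤ max v V := le_trans hV0.le (le_max_right _ _); positivity
  have hφm : ∀ v w, 0 ≤ v → v ≤ w → φ w ≤ φ v := by
    intro v w hv hvw
    simp only [hφ]
    have hmv : 0 ≤ max v V := le_trans hV0.le (le_max_right _ _)
    have hm : max v V ≤ max w V := max_le_max hvw le_rfl
    apply one_div_le_one_div_of_le (by positivity)
    have h1 := mul_le_mul_of_nonneg_left hm (div_pos hA hN0).le
    have h2 := mul_le_mul_of_nonneg_left hm (div_pos hB hN0).le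
    exact mul_le_mul (by linarith) (by linarith) (by positivity) (by positivity)
  -- the filtered sum against `Σ_r φ(N₀‖·‖)`
  have hcmp : ∑ r ∈ (Finset.range N₀).filter (fun r : ℕ => ρ < distInt ((r : ℝ) / N₀ - c)),
      1 / ((1 + A * distInt ((r : ℝ) / N₀ - c)) * (1 + B * distInt ((r : ℝ) / N₀ - c))) ≤
      ∑ r ∈ Finset.range N₀, φ (N₀ * distInt ((r : ℝ) / N₀ - c)) := by
    rw [← Finset.sum_filter_add_sum_filter_not (Finset.range N₀) (fun r : ℕ => ρ < distInt ((r : ℝ) / N₀ - c))]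
    refine le_trans (le_of_eq (Finset.sum_congr rfl fun r hr => ?_))
      (le_add_of_nonneg_right (Finset.sum_nonneg fun r _ => hφ0 _ (by have := distInt_nonneg ((r : ℝ) / N₀ - c); positivity)))
    have hr' := (Finset.mem_filter.mp hr).2
    have hmax : max ((N₀ : ℝ) * distInt ((r : ℝ) / N₀ - c)) V = N₀ * distInt ((r : ℝ) / N₀ - c) := by
      rw [max_eq_left]; rw [hV, mul_comm]; exact mul_le_mul_of_nonneg_left hr'.le hN0.le
    simp only [hφ, hmax]
    congr 2 <;> field_simp
  refine hcmp.trans ((sum_range_antitone_distInt_le hN c hφ0 hφm).trans ?_)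
  -- `Σ_{j<N₀} φ(j) ≤ 4N₀/(ABρ)`
  set U : ℕ := ⌊V⌋₊ with hU
  have hUle : (U : ℝ) ≤ V := Nat.floor_le hV0.le
  have hUlt : V < (U : ℝ) + 1 := Nat.lt_floor_add_one V
  have hU1 : 1 ≤ U := Nat.le_floor (by simpa using hρN)
  have hpart1 : ∑ j ∈ (Finset.range N₀).filter (fun j => j ≤ U), φ j ≤ 2 * N₀ / (A * B * ρ) := by
    have hterm : ∀ j ∈ (Finset.range N₀).filter (fun j => j ≤ U), φ j ≤ 1 / (A * B * ρ ^ 2) := by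
      intro j _
      simp only [hφ]
      have hm : V ≤ max (j : ℝ) V := le_max_right _ _
      apply one_div_le_one_div_of_le (by positivity)
      have h1 : A * ρ ≤ 1 + A / N₀ * max (j : ℝ) V := by
        have := mul_le_mul_of_nonneg_left hm (div_pos hA hN0).le
        have e : A / N₀ * V = A * ρ := by rw [hV]; field_simp
        linarith [this, e.symm.le]
      have h2 : B * ρ ≤ 1 + B / N₀ * max (j : ℝ) V := by
        have := mul_le_mul_of_nonneg_left hm (div_pos hB hN0).le
        have e : B / N₀ * V = B * ρ := by rw [hV]; field_simp
        linarith [this, e.symm.le]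
      calc A * B * ρ ^ 2 = (A * ρ) * (B * ρ) := by ring
        _ ≤ _ := mul_le_mul h1 h2 (by positivity) (by positivity)
    refine (Finset.sum_le_sum hterm).trans ?_
    rw [Finset.sum_const, nsmul_eq_mul]
    have hcard : (((Finset.range N₀).filter (fun j => j ≤ U)).card : ℝ) ≤ U + 1 := by
      have : (Finset.range N₀).filter (fun j => j ≤ U) ⊆ Finset.range (U + 1) := by
        intro j hj; exact Finset.mem_range.mpr (by have := (Finset.mem_filter.mp hj).2; omega)
      exact_mod_cast (Finset.card_le_card this).trans (Finset.card_range _).le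
    have h1U : (1 : ℝ) ≤ U := by exact_mod_cast hU1
    have hU2 : (U : ℝ) + 1 ≤ 2 * V := by linarith
    calc (((Finset.range N₀).filter (fun j => j ≤ U)).card : ℝ) * (1 / (A * B * ρ ^ 2))
        ≤ (2 * V) * (1 / (A * B * ρ ^ 2)) := mul_le_mul_of_nonneg_right (hcard.trans hU2) (by positivity)
      _ = 2 * N₀ / (A * B * ρ) := by rw [hV]; field_simp
  have hpart2 : ∑ j ∈ (Finset.range N₀).filter (fun j => ¬ j ≤ U), φ j ≤ 2 * N₀ / (A * B * ρ) := by
    have hsub : (Finset.range N₀).filter (fun j => ¬ j ≤ U) ⊆ Ioo U N₀ := by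
      intro j hj
      rw [Finset.mem_filter, Finset.mem_range] at hj
      exact Finset.mem_Ioo.mpr ⟨by omega, hj.1⟩
    have hkey : ∀ j ∈ Ioo U N₀, φ j ≤ ((N₀ : ℝ) ^ 2 / (A * B)) * ((j : ℝ) ^ 2)⁻¹ := by
      intro j hj
      have hjU : (U : ℝ) + 1 ≤ j := by exact_mod_cast (Finset.mem_Ioo.mp hj).1
      have hjV : V ≤ j := by linarith
      have hj0 : (0 : ℝ) < j := by linarith
      simp only [hφ, max_eq_left hjV]
      have haj : 0 < A / N₀ * j := by positivity
      have hbj : 0 < B / N₀ * j := by positivity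
      calc 1 / ((1 + A / N₀ * j) * (1 + B / N₀ * j)) ≤ 1 / ((A / N₀ * j) * (B / N₀ * j)) :=
            one_div_le_one_div_of_le (mul_pos haj hbj) (by nlinarith)
        _ = ((N₀ : ℝ) ^ 2 / (A * B)) * ((j : ℝ) ^ 2)⁻¹ := by field_simp
    calc ∑ j ∈ (Finset.range N₀).filter (fun j => ¬ j ≤ U), φ j ≤ ∑ j ∈ Ioo U N₀, φ j :=
          Finset.sum_le_sum_of_subset_of_nonneg hsub fun j _ _ => hφ0 _ (Nat.cast_nonneg j)
      _ ≤ ∑ j ∈ Ioo U N₀, ((N₀ : ℝ) ^ 2 / (A * B)) * ((j : ℝ) ^ 2)⁻¹ := Finset.sum_le_sum hkey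
      _ = ((N₀ : ℝ) ^ 2 / (A * B)) * ∑ j ∈ Ioo U N₀, ((j : ℝ) ^ 2)⁻¹ := by rw [Finset.mul_sum]
      _ ≤ ((N₀ : ℝ) ^ 2 / (A * B)) * (2 / (U + 1)) :=
          mul_le_mul_of_nonneg_left (sum_Ioo_inv_sq_le U N₀) (by positivity)
      _ ≤ ((N₀ : ℝ) ^ 2 / (A * B)) * (2 / V) := by
          refine mul_le_mul_of_nonneg_left (div_le_div_of_nonneg_left (by norm_num) hV0 hUlt.le) (by positivity)
      _ = 2 * N₀ / (A * B * ρ) := by rw [hV]; field_simp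
  rw [← Finset.sum_filter_add_sum_filter_not (Finset.range N₀) (fun j => j ≤ U)]
  have e : 16 * (N₀ : ℝ) / (A * B * ρ) = 4 * (2 * N₀ / (A * B * ρ) + 2 * N₀ / (A * B * ρ)) := by ring
  rw [e]
  exact mul_le_mul_of_nonneg_left (add_le_add hpart1 hpart2) (by norm_num)


end SmoothArcs

end Literature.NumberTheory.Sieve

end
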